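import Summits.FinalStateConjecture.FinalStateConjecture.Theorems.BartnikGapSettlingSettledCaptureCrushChartImmersion
import Summits.FinalStateConjecture.FinalStateConjecture.Theorems.BartnikGapSettlingSettledCaptureCrushChartGeodesicLift
import Summits.FinalStateConjecture.FinalStateConjecture.Theorems.BartnikGapSettlingSettledCaptureCrushShellConstants
import Literature.Geometry.Lorentzian.KerrSchildChartCovariance
import Literature.Geometry.Lorentzian.ConvergenceTransport
import HarnessLib

/-!
# Crux `SettledCapture` (stmt-FinalStateConjecture-17328), line `null-concave-crush`:
# stub 3a `stub_chartNullGeodesic` — a normalised null ray in a good interior chart is a coordinate null geodesic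

Route `BartnikGapSettling`; helper (`--supports stmt-FinalStateConjecture-17328`) landing the registered stub
`stub_chartNullGeodesic` (the MANIFOLD PLUMBING half of the crush transport, skeleton
`Cruxes/SettledCapture/Lines/null_concave_crush.lean` rev 5) from the two landed bricks
`stub_crushChartImmersion` (an `η`-good interior chart is an immersion on its late shell, `η ≤ η₁`) and
`stub_crushChartGeodesicLift` (geodesics in an immersed open chart pull back to coordinate geodesics):

for `η ≤ η₁(M, a, δ, mo)` and an `η`-good interior chart `Φ` on the late shell `{t* > T, r₋ + δ/2 < r < r₊}`, every
normalised null ray `γ` of the development whose tail lies in `Φ '' {t* > T, r₋ + δ < r < r₊ − δ}` pulls back to a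
`C²` coordinate curve `β` with velocity `β₁`, solving `β₁' = −Γ_G(β₁, β₁)` for the chart components
`G = g_{M,a,Λ,c} + (Φ^*g − g_{M,a,Λ,c})`, `G`-NULL (`γ` is null, `G = Φ^*g` on the shell), `G`-FUTURE against the
transported Kerr field `Λ V` (`γ'` future causal, `dΦ(ΛV)` future TIMELIKE — timelike because
`(Φ^*g)(ΛV, ΛV) = −1 − 2H + O(η‖Λ‖²‖V‖²) < 0` for `η ≤ η₁`, `‖V‖ ≤ 1 + 2√2 M/(r₋ + δ/2)` on the shell — and
`LorentzianMetric.val_lt_zero_of_isCausal`), with the `C⁰` and `C¹` jets of the deviation at `β t` within `η`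
(`supCkENorm ≤ η` read at orders `0`, `1`; the chart components are smooth, `KerrSchildChart.contDiffAt_chartMetric`).

References: O'Neill 1983, Ch. 3 (Cor. 21, Prop. 3.59), Ch. 5 (Lemma 5.26, p. 145); Kerr–Schild 1965, §2.
-/

noncomputable section

-- instance search through the nested operator types `E4 →L[ℝ] E4 →L[ℝ] E4 →L[ℝ] ℝ`
set_option maxSynthPendingDepth 3

-- D-0017: single-problem summit, `Summit.<S>.<S>.…` by design (cf. lakefile `weak.linter.dupNamespace`).
set_option linter.dupNamespace false

namespace Summit.FinalStateConjecture.FinalStateConjecture.Theorems.BartnikGapSettling.SettledCapture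

open Set Filter Function TopologicalSpace
open scoped Manifold ContDiff Topology ENNReal
open Literature.Geometry.Lorentzian Literature.Geometry.Lorentzian.MetricCoord
open Summit.FinalStateConjecture.FinalStateConjecture.Theorems

/-! ### Bounds on the Kerr orienting field `V = ∂₀ − 2H ℓ♯` on a band -/

/-- `‖ℓ♯‖ ≤ √2` wherever `r > 0` (`ℓ♯ = (−1, ℓ⃗)` with `|ℓ⃗| = 1`). [folklore] -/
private theorem chart_norm_nullVector_le {a : ℝ} {x : E4} (hx : 0 < Kerr.radius a x) :
    ‖Kerr.nullVector a x‖ ≤ Real.sqrt 2 := by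
  have hsq : ‖Kerr.nullVector a x‖ ^ 2 = 2 := by
    rw [EuclideanSpace.real_norm_sq_eq, Fin.sum_univ_four]
    simp only [Kerr.nullVector_apply_zero, Kerr.nullVector_apply_one, Kerr.nullVector_apply_two,
      Kerr.nullVector_apply_three]
    have h := Kerr.sum_sq_nullCovectorFun hx
    nlinarith [h]
  have h : ‖Kerr.nullVector a x‖ = Real.sqrt (‖Kerr.nullVector a x‖ ^ 2) :=
    (Real.sqrt_sq (norm_nonneg _)).symm
  rw [h, hsq]

/-- `0 ≤ H ≤ M / r_lo` on `{r ≥ r_lo > 0}` (`H = M r³/(r⁴ + a²z²) ≤ M/r`), for `M ≥ 0`. [folklore] -/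
private theorem chart_scalarH_le {M a r_lo : ℝ} (hM : 0 ≤ M) (hlo : 0 < r_lo) {x : E4}
    (hx : r_lo ≤ Kerr.radius a x) : Kerr.scalarH M a x ≤ M / r_lo := by
  have hr : 0 < Kerr.radius a x := hlo.trans_le hx
  unfold Kerr.scalarH
  have hden : 0 < Kerr.radius a x ^ 4 + a ^ 2 * x 3 ^ 2 := by positivity
  rw [div_le_div_iff₀ hden hlo]
  have h1 : M * Kerr.radius a x ^ 3 * r_lo ≤ M * Kerr.radius a x ^ 3 * Kerr.radius a x :=
    mul_le_mul_of_nonneg_left hx (by positivity)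
  have h2 : M * Kerr.radius a x ^ 3 * Kerr.radius a x = M * Kerr.radius a x ^ 4 := by ring
  have h3 : M * Kerr.radius a x ^ 4 ≤ M * (Kerr.radius a x ^ 4 + a ^ 2 * x 3 ^ 2) :=
    mul_le_mul_of_nonneg_left (le_add_of_nonneg_right (by positivity)) hM
  linarith

/-- `‖V‖ ≤ 1 + 2 (M/r_lo) √2` on `{r ≥ r_lo > 0}` for the orienting field `V = ∂₀ − 2H ℓ♯`, `M ≥ 0`. [folklore] -/
private theorem chart_norm_timeVector_le {M a r_lo : ℝ} (hM : 0 ≤ M) (hlo : 0 < r_lo) {x : E4}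
    (hx : r_lo ≤ Kerr.radius a x) : ‖Kerr.timeVector M a x‖ ≤ 1 + 2 * (M / r_lo) * Real.sqrt 2 := by
  have hr : 0 < Kerr.radius a x := hlo.trans_le hx
  have hH0 : 0 ≤ Kerr.scalarH M a x := Kerr.scalarH_nonneg hM a x
  have hH := chart_scalarH_le (a := a) hM hlo hx
  unfold Kerr.timeVector
  calc ‖E4.basisVector 0 - (2 * Kerr.scalarH M a x) • Kerr.nullVector a x‖
      ≤ ‖E4.basisVector 0‖ + ‖(2 * Kerr.scalarH M a x) • Kerr.nullVector a x‖ := norm_sub_le _ _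
    _ = 1 + 2 * Kerr.scalarH M a x * ‖Kerr.nullVector a x‖ := by
        rw [norm_smul, Real.norm_eq_abs, abs_of_nonneg (by positivity)]
        simp [E4.basisVector]
    _ ≤ 1 + 2 * (M / r_lo) * Real.sqrt 2 := by
        have := mul_le_mul hH (chart_norm_nullVector_le hr) (norm_nonneg _) (by positivity)
        nlinarith

/-- The boosted Kerr–Schild form is smooth wherever the rest-frame radius is positive. [cite: KerrSchild1965, §2] -/
private theorem chart_contDiffAt_boostedKerrBilin (mo : lorentzGroup × E4) (M a : ℝ) {y : E4}
    (hy : 0 < Kerr.radius a (poincareInv mo.1 mo.2 y)) {n : WithTop ℕ∞} :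
    ContDiffAt ℝ n (boostedKerrBilin mo.1 mo.2 M a) y := by
  have h1 : ContDiffAt ℝ n (fun x ↦ Kerr.bilin M a (poincareInv mo.1 mo.2 x)) y :=
    (Kerr.contDiffAt_bilin M a hy).comp y (KerrSchildChart.contDiff_poincareInv mo.1 mo.2).contDiffAt
  have heq : boostedKerrBilin mo.1 mo.2 M a = fun x ↦
      (ContinuousLinearMap.precomp ℝ ((mo.1 : E4 ≃L[ℝ] E4).symm : E4 →L[ℝ] E4)).comp
        ((Kerr.bilin M a (poincareInv mo.1 mo.2 x)).comp ((mo.1 : E4 ≃L[ℝ] E4).symm : E4 →L[ℝ] E4)) := by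
    funext x
    rfl
  rw [heq]
  exact contDiffAt_const.clm_comp (h1.clm_comp contDiffAt_const)

/-! ### The stub -/

/-- **Stub 3a of line `null-concave-crush` (crux `SettledCapture`, stmt-FinalStateConjecture-17328): a normalised null
ray in an `η`-good interior chart, `η ≤ η₁(M, a, δ, mo)`, is a coordinate null geodesic of the chart components, future
against the transported Kerr field, with `η`-small jets of the deviation along it.** See the module docstring.
[folklore] -/
theorem stub_chartNullGeodesic : ∀ (M a δ : ℝ) (mo : lorentzGroup × E4), 0 < M → |a| < M → 0 < δ → ∃ η₁ : ℝ≥0∞, 0 < η₁ ∧ ∀ (X : Type) [TopologicalSpace X] [ChartedSpace E3 X] [IsManifold (𝓡 3) ((⊤ : ℕ∞) : WithTop ℕ∞) X] [T2Space X] [SecondCountableTopology X] [ConnectedSpace X] (D : InitialDataSet (𝓡 3) X) (𝒟 : VacuumCauchyDevelopment D) (Φ : (interiorBackground mo M a (Kerr.rMinus M a)).domain → 𝒟.carrier) (T : ℝ) (η : ℝ≥0∞), η ≤ η₁ → IsGoodInteriorChart 𝒟 mo M a Φ T (Kerr.rMinus M a + δ / 2) (Kerr.rPlus M a) η → ∀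 [𝒟.metric.HasLeviCivita], ∀ (p : X) (γ : ℝ → 𝒟.carrier) (dom : Set ℝ), 𝒟.metric.IsNormalisedNullRayFrom 𝒟.timeOrientation 𝒟.embed 𝒟.normal p γ dom → ∀ t₀ ∈ dom, (∀ t ∈ dom, t₀ ≤ t → γ t ∈ Φ '' lateShell (interiorBackground mo M a (Kerr.rMinus M a)) T (Kerr.rMinus M a + δ) (Kerr.rPlus M a - δ)) → ∃ β β₁ : ℝ → E4, ∀ t ∈ dom, t₀ ≤ t → (∃ x ∈ lateShell (interiorBackground mo M a (Kerr.rMinus M a)) T (Kerr.rMinus M a + δ) (Kerr.rPlus M a - δ), Φ x = γ t ∧ β t = x.1) ∧ ContDiffAt ℝ 2 β t ∧ HasDerivAt β (β₁ t) t ∧ HasDerivAt β₁ (-(MetricCoord.chrAt (fun y ↦ boostedKerrBilin mo.1 mo.2 M a y + 𝒟.toSpacetime.deviationExtend (interiorBackground mo M a (Kerr.rMinus M a)) Φ y) (β t) (β₁ t) (β₁ t))) t ∧ (boostedKerrBilin mo.1 mo.2 M a (β t) + 𝒟.toSpacetime.deviationExtend (interiorBackground mo M a (Kerr.rMinus M a))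 Φ (β t)) (β₁ t) (β₁ t) = 0 ∧ (boostedKerrBilin mo.1 mo.2 M a (β t) + 𝒟.toSpacetime.deviationExtend (interiorBackground mo M a (Kerr.rMinus M a)) Φ (β t)) (β₁ t) ((mo.1 : E4 ≃L[ℝ] E4) (Kerr.timeVector M a (poincareInv mo.1 mo.2 (β t)))) < 0 ∧ ‖𝒟.toSpacetime.deviationExtend (interiorBackground mo M a (Kerr.rMinus M a)) Φ (β t)‖ ≤ η.toReal ∧ ‖fderiv ℝ (fun y ↦ boostedKerrBilin mo.1 mo.2 M a y + 𝒟.toSpacetime.deviationExtend (interiorBackground mo M a (Kerr.rMinus M a)) Φ y) (β t) - fderiv ℝ (boostedKerrBilin mo.1 mo.2 M a) (β t)‖ ≤ η.toReal := by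
  intro M a δ mo hM ha hδ
  obtain ⟨η₀, hη₀, hη₀top, himm⟩ := stub_crushChartImmersion M a δ mo hM ha hδ
  -- the radial band of the big shell and the size of the orienting field there
  have hr₀ : 0 < Kerr.rMinus M a + δ / 2 := by
    have := Kerr.IsSubextremal.rMinus_nonneg ha; linarith
  set CV : ℝ := 1 + 2 * (M / (Kerr.rMinus M a + δ / 2)) * Real.sqrt 2 with hCV
  have hCV0 : 0 < CV := by rw [hCV]; positivity
  set L : E4 →L[ℝ] E4 := ((mo.1 : E4 ≃L[ℝ] E4) : E4 →L[ℝ] E4) with hL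
  set η₂ : ℝ := 1 / (2 * (‖L‖ ^ 2 * CV ^ 2 + 1)) with hη₂
  have hη₂0 : 0 < η₂ := by rw [hη₂]; positivity
  refine ⟨min η₀ (ENNReal.ofReal η₂), lt_min hη₀ (ENNReal.ofReal_pos.2 hη₂0), ?_⟩
  intro X _ _ _ _ _ _ D 𝒟 Φ T η hη hgood inst p γ dom hγ t₀ ht₀ htail
  have hη' : η ≤ η₀ := hη.trans (min_le_left _ _)
  have hηtop : η ≠ ⊤ := ne_top_of_le_ne_top hη₀top.ne hη'
  have hη₂' : η.toReal ≤ η₂ := ENNReal.toReal_le_of_le_ofReal hη₂0.le (hη.trans (min_le_right _ _))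
  have himm' := himm X D 𝒟 Φ T η hη' hgood
  obtain ⟨hsm, hemb, -, hor, hsup⟩ := hgood
  have hopen := stub_isOpen_lateShell_interiorBackground mo M a (Kerr.rMinus M a) T
    (Kerr.rMinus M a + δ / 2) (Kerr.rPlus M a)
  have hsub : lateShell (interiorBackground mo M a (Kerr.rMinus M a)) T (Kerr.rMinus M a + δ) (Kerr.rPlus M a - δ) ⊆
      lateShell (interiorBackground mo M a (Kerr.rMinus M a)) T (Kerr.rMinus M a + δ / 2) (Kerr.rPlus M a) :=
    lateShell_mono _ le_rfl (by linarith) (by linarith)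
  /- the chart components `G = g_B + (Φ^*g − g_B)` are those of `Φ^*g` on the big shell -/
  have hGS : ∀ x ∈ lateShell (interiorBackground mo M a (Kerr.rMinus M a)) T (Kerr.rMinus M a + δ / 2) (Kerr.rPlus M a),
      ∀ v w : E4, (fun y ↦ boostedKerrBilin mo.1 mo.2 M a y +
        𝒟.toSpacetime.deviationExtend (interiorBackground mo M a (Kerr.rMinus M a)) Φ y) x.1 v w =
        𝒟.metric.val (Φ x) (mfderiv 𝓘(ℝ, E4) (𝓡 4) Φ x v) (mfderiv 𝓘(ℝ, E4) (𝓡 4) Φ x w) := by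
    intro x _ v w
    simp only [Spacetime.deviationExtend_coe, _root_.add_apply, Spacetime.deviation_apply]
    show boostedKerrBilin mo.1 mo.2 M a x.1 v w + (_ - boostedKerrBilin mo.1 mo.2 M a x.1 v w) = _
    ring
  /- the lift -/
  obtain ⟨β, β₁, hβ⟩ := stub_crushChartGeodesicLift 𝒟.toSpacetime (interiorBackground mo M a (Kerr.rMinus M a)).domain
    Φ _ hopen hsm hemb (fun x hx ↦ (himm' x hx).2)
    (fun y ↦ boostedKerrBilin mo.1 mo.2 M a y +
      𝒟.toSpacetime.deviationExtend (interiorBackground mo M a (Kerr.rMinus M a)) Φ y)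
    hGS γ dom hγ.isMaximalGeodesicOn t₀ ht₀
    (fun t ht htt ↦ image_mono hsub (htail t ht htt))
  refine ⟨β, β₁, fun t ht htt ↦ ?_⟩
  obtain ⟨⟨x, hxbig, hΦx, hβx, hdΦ⟩, hC2, hβ', hβ₁'⟩ := hβ t ht htt
  -- `x` is in fact in the small shell (injectivity of `Φ` on the big shell)
  have hxsmall : x ∈ lateShell (interiorBackground mo M a (Kerr.rMinus M a)) T (Kerr.rMinus M a + δ) (Kerr.rPlus M a - δ) := by
    obtain ⟨x', hx', hΦx'⟩ := htail t ht htt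
    have h : (Set.restrict _ Φ) ⟨x, hxbig⟩ = (Set.restrict _ Φ) ⟨x', hsub hx'⟩ := by
      show Φ x = Φ x'
      rw [hΦx, hΦx']
    have hxx' : x = x' := congrArg Subtype.val (hemb.injective h)
    rw [hxx']; exact hx'
  obtain ⟨hdev0, -⟩ := himm' x hxbig
  have hxr : Kerr.rMinus M a + δ / 2 ≤ Kerr.radius a (poincareInv mo.1 mo.2 x.1) := hxbig.2.1.le
  have hxr0 : 0 < Kerr.radius a (poincareInv mo.1 mo.2 x.1) := hr₀.trans_le hxr
  -- the velocity of `γ` at `t`: null and future-directed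
  obtain ⟨hnull, hfd⟩ := hγ.isNull_and_isFutureDirected_velocity_of_mem ht
  refine ⟨⟨x, hxsmall, hΦx, hβx⟩, hC2, hβ', hβ₁', ?_, ?_, ?_, ?_⟩
  · -- `G`-null
    rw [hβx, hGS x hxbig, hdΦ]
    exact hΦx ▸ hnull.1
  · -- `G`-future against `Λ V`
    rw [hβx, hGS x hxbig, hdΦ]
    set T' := mfderiv 𝓘(ℝ, E4) (𝓡 4) Φ x (L (Kerr.timeVector M a (poincareInv mo.1 mo.2 x.1))) with hT'
    have hT'fd : 𝒟.timeOrientation.IsFutureDirected T' := hor x hxbig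
    -- `T'` is timelike: `(Φ^*g)(ΛV, ΛV) = −1 − 2H + dev(ΛV, ΛV) < 0`
    have hT'tl : 𝒟.metric.IsTimelike T' := by
      rw [LorentzianMetric.IsTimelike, hT', ← hGS x hxbig]
      simp only [_root_.add_apply, Spacetime.deviationExtend_coe]
      have hB : boostedKerrBilin mo.1 mo.2 M a x.1 (L (Kerr.timeVector M a (poincareInv mo.1 mo.2 x.1)))
          (L (Kerr.timeVector M a (poincareInv mo.1 mo.2 x.1))) = -1 - 2 * Kerr.scalarH M a (poincareInv mo.1 mo.2 x.1) := by
        rw [boostedKerrBilin_apply, hL, ContinuousLinearEquiv.coe_coe, ContinuousLinearEquiv.symm_apply_apply]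
        exact Kerr.bilin_timeVector_timeVector hxr0
      rw [hB]
      have hH0 : 0 ≤ Kerr.scalarH M a (poincareInv mo.1 mo.2 x.1) := Kerr.scalarH_nonneg hM.le a _
      have hV : ‖Kerr.timeVector M a (poincareInv mo.1 mo.2 x.1)‖ ≤ CV := chart_norm_timeVector_le hM.le hr₀ hxr
      have hLV : ‖L (Kerr.timeVector M a (poincareInv mo.1 mo.2 x.1))‖ ≤ ‖L‖ * CV :=
        (L.le_opNorm _).trans (mul_le_mul_of_nonneg_left hV (norm_nonneg _))
      have hd : |𝒟.toSpacetime.deviation (interiorBackground mo M a (Kerr.rMinus M a)) Φ x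
          (L (Kerr.timeVector M a (poincareInv mo.1 mo.2 x.1))) (L (Kerr.timeVector M a (poincareInv mo.1 mo.2 x.1)))| ≤ 1 / 2 := by
        have h1 := ContinuousLinearMap.le_opNorm₂ (𝒟.toSpacetime.deviation (interiorBackground mo M a (Kerr.rMinus M a)) Φ x)
          (L (Kerr.timeVector M a (poincareInv mo.1 mo.2 x.1))) (L (Kerr.timeVector M a (poincareInv mo.1 mo.2 x.1)))
        rw [Real.norm_eq_abs] at h1
        have h2 : ‖𝒟.toSpacetime.deviation (interiorBackground mo M a (Kerr.rMinus M a)) Φ x‖ *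
            ‖L (Kerr.timeVector M a (poincareInv mo.1 mo.2 x.1))‖ * ‖L (Kerr.timeVector M a (poincareInv mo.1 mo.2 x.1))‖ ≤
            η₂ * (‖L‖ * CV) * (‖L‖ * CV) := by
          have h0 : 0 ≤ ‖L‖ * CV := by positivity
          exact mul_le_mul (mul_le_mul (hdev0.trans hη₂') hLV (norm_nonneg _) hη₂0.le) hLV (norm_nonneg _)
            (by positivity)
        have h3 : η₂ * (‖L‖ * CV) * (‖L‖ * CV) ≤ 1 / 2 := by
          rw [hη₂]
          have hpos : 0 < ‖L‖ ^ 2 * CV ^ 2 + 1 := by positivity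
          rw [show 1 / (2 * (‖L‖ ^ 2 * CV ^ 2 + 1)) * (‖L‖ * CV) * (‖L‖ * CV) =
            (‖L‖ ^ 2 * CV ^ 2) / (2 * (‖L‖ ^ 2 * CV ^ 2 + 1)) by ring]
          rw [div_le_div_iff₀ (by positivity) two_pos]
          nlinarith
        linarith
      have := neg_abs_le (𝒟.toSpacetime.deviation (interiorBackground mo M a (Kerr.rMinus M a)) Φ x
        (L (Kerr.timeVector M a (poincareInv mo.1 mo.2 x.1))) (L (Kerr.timeVector M a (poincareInv mo.1 mo.2 x.1))))
      have := le_abs_self (𝒟.toSpacetime.deviation (interiorBackground mo M a (Kerr.rMinus M a)) Φ x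
        (L (Kerr.timeVector M a (poincareInv mo.1 mo.2 x.1))) (L (Kerr.timeVector M a (poincareInv mo.1 mo.2 x.1))))
      linarith
    -- the time cone at `γ t = Φ x`: `g(T', γ') < 0` since both are future-directed
    have hT'tl' : 𝒟.metric.IsTimelike (x := γ t) T' := hΦx ▸ hT'tl
    have hT'fd' : 𝒟.timeOrientation.IsFutureDirected (x := γ t) T' := hΦx ▸ hT'fd
    have hcausal : 𝒟.metric.IsCausal (velocity (𝓡 4) γ t) := ⟨hnull.1.le, hnull.2⟩
    have hcone := 𝒟.metric.val_lt_zero_of_isCausal (𝒟.timeOrientation.isTimelike (γ t)) hT'tl' hT'fd'.2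
      hcausal hfd.2
    rw [𝒟.metric.symm]
    exact hΦx ▸ hcone
  · -- the `C⁰` jet
    rw [hβx, Spacetime.deviationExtend_coe]
    exact hdev0
  · -- the `C¹` jet: the components of `Φ^*g` are smooth near `x.1`, so the difference of derivatives is `D(dev)`
    -- restrict `Φ` to the open big shell `W` to read smoothness of the chart components
    set S := lateShell (interiorBackground mo M a (Kerr.rMinus M a)) T (Kerr.rMinus M a + δ / 2) (Kerr.rPlus M a) with hSdef
    set W : Opens E4 := ⟨Subtype.val '' S,
      (interiorBackground mo M a (Kerr.rMinus M a)).domain.isOpen.isOpenMap_subtype_val S hopen⟩ with hWdef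
    have hWU : W ≤ (interiorBackground mo M a (Kerr.rMinus M a)).domain := by
      rintro z ⟨x, -, rfl⟩; exact x.2
    have hιS : ∀ y : W, Opens.inclusion hWU y ∈ S := by
      intro y
      obtain ⟨x', hx', hxy⟩ := (show (y : E4) ∈ Subtype.val '' S from y.2)
      have : Opens.inclusion hWU y = x' := Subtype.ext (by rw [← hxy])
      rw [this]; exact hx'
    have hΦW : ContMDiff 𝓘(ℝ, E4) (𝓡 4) ∞ (Φ ∘ Opens.inclusion hWU) :=
      hsm.comp_contMDiff (contMDiff_inclusion hWU) fun y ↦ hιS y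
    have hGp : ∀ y : W, pullbackBilin (I := 𝓡 4) (I' := 𝓘(ℝ, E4)) (Φ ∘ Opens.inclusion hWU) 𝒟.metric.val y =
        (fun z ↦ boostedKerrBilin mo.1 mo.2 M a z +
          𝒟.toSpacetime.deviationExtend (interiorBackground mo M a (Kerr.rMinus M a)) Φ z) y := by
      intro y
      ext v w
      rw [pullbackBilin_apply,
        mfderiv_comp_inclusion hWU ((hsm.contMDiffAt (hopen.mem_nhds (hιS y))).mdifferentiableAt (by simp))]
      exact (hGS _ (hιS y) v w).symm
    have hxW : x.1 ∈ W := mem_image_of_mem _ hxbig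
    have hGsm : ContDiffAt ℝ ∞ (fun z ↦ boostedKerrBilin mo.1 mo.2 M a z +
        𝒟.toSpacetime.deviationExtend (interiorBackground mo M a (Kerr.rMinus M a)) Φ z) x.1 :=
      KerrSchildChart.contDiffAt_chartMetric hΦW hGp ⟨x.1, hxW⟩
    have hBsm : ContDiffAt ℝ ∞ (boostedKerrBilin mo.1 mo.2 M a) x.1 := chart_contDiffAt_boostedKerrBilin mo M a hxr0
    have hGd : DifferentiableAt ℝ (fun z ↦ boostedKerrBilin mo.1 mo.2 M a z +
        𝒟.toSpacetime.deviationExtend (interiorBackground mo M a (Kerr.rMinus M a)) Φ z) x.1 :=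
      hGsm.differentiableAt (by simp)
    have hBd : DifferentiableAt ℝ (boostedKerrBilin mo.1 mo.2 M a) x.1 := hBsm.differentiableAt (by simp)
    have hDd : DifferentiableAt ℝ (𝒟.toSpacetime.deviationExtend (interiorBackground mo M a (Kerr.rMinus M a)) Φ) x.1 :=
      (hGd.sub hBd).congr_of_eventuallyEq (Filter.Eventually.of_forall fun y ↦ (add_sub_cancel_left _ _).symm)
    have hdiff : fderiv ℝ (fun z ↦ boostedKerrBilin mo.1 mo.2 M a z +
        𝒟.toSpacetime.deviationExtend (interiorBackground mo M a (Kerr.rMinus M a)) Φ z) x.1 -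
        fderiv ℝ (boostedKerrBilin mo.1 mo.2 M a) x.1 =
        fderiv ℝ (𝒟.toSpacetime.deviationExtend (interiorBackground mo M a (Kerr.rMinus M a)) Φ) x.1 := by
      have hfun : (fun z ↦ boostedKerrBilin mo.1 mo.2 M a z +
          𝒟.toSpacetime.deviationExtend (interiorBackground mo M a (Kerr.rMinus M a)) Φ z) =
          boostedKerrBilin mo.1 mo.2 M a + 𝒟.toSpacetime.deviationExtend (interiorBackground mo M a (Kerr.rMinus M a)) Φ :=
        rfl
      rw [hfun, fderiv_add hBd hDd, add_sub_cancel_left]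
    rw [hβx, hdiff]
    -- order-1 readout of `supCkENorm ≤ η`
    have hle := (enorm_iteratedFDeriv_le_supCkENorm (k := 1) (m := 1) le_rfl (mem_image_of_mem Subtype.val hxbig)
      (𝒟.toSpacetime.deviationExtend (interiorBackground mo M a (Kerr.rMinus M a)) Φ)).trans hsup
    have h1 : ‖iteratedFDeriv ℝ 1 (𝒟.toSpacetime.deviationExtend (interiorBackground mo M a (Kerr.rMinus M a)) Φ) x.1‖ ≤
        η.toReal := by
      rw [← toReal_enorm]
      exact ENNReal.toReal_mono hηtop hle
    rwa [← norm_iteratedFDeriv_fderiv, norm_iteratedFDeriv_zero] at h1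

end Summit.FinalStateConjecture.FinalStateConjecture.Theorems.BartnikGapSettling.SettledCapture

end
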